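import Literature.AnabelianGeometry.SemiGraphs.ThetaRayEscape
import Literature.AnabelianGeometry.SemiGraphs.TemperedMaximalCompactZornLimit
import Literature.AnabelianGeometry.SemiGraphs.TemperedMaximalCompactFalseOfEscaping
import HarnessLib

/-!
# The escape at the canonical chart of `𝒢_θ`, EXPORTED, and Thm 3.7 (iv) (REFUTE-F1732, (iv) row at the canonical chart)

Mochizuki, *Semi-graphs of anabelioids*, Publ. RIMS **42** (2006), §3, Thm. 3.7 (iii)/(iv) pp. 40–41
[cite: MochizukiSemiAnbd2006, Thm 3.7(iv) p.41]; the printed proof covers FINITE `𝔾` (kernel: p431007).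
FRONTIER programme REFUTE-F1732 (plan/L3/SUBDAG-SemiAnbd-Thm37iii-REFUTE.md; honest framing α59: towards a
kernel erratum for the ∀-countable reading; desk countermodel `𝒢_θ` of abc-iut-L3-d1, four concurring readers).

PROOF-ONLY ADDITIVE sequel of abc-iut-L3-d4's `ThetaRayEscape.lean` (p438249; nothing of it edited) — seat
abc-iut-w6-d120 ((iv)-Zorn holder), answering abc-iut-L3-t10's junction recon note (10:56:17Z): the same
level-wise binders (hz) (hfin) (hfar) (hcrit) on a sequence `z : ℕ → π₁^temp(𝒢_θ)` yield

* `thetaRay_exists_compact_escaping_of_levelEscape` — an EXPORTED compact subgroup `C` of `π₁^temp` (the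
  closure of `⟨lim z_k⟩`) that ESCAPES at the canonical level data `verticialLevelData_temperedPiChart`
  (`hesc`: no compatible system of tree vertices is fixed by `C`) — d4's proof of p438249 with `C`, `hC`,
  `hesc` exported instead of consumed;
* `thetaRay_not_maximalCompactIffVerticialAt_of_levelEscape` / `…MaximalCompactIffVerticial_of_levelEscape` —
  hence, with ONE more level binder `hbd` («the finite subgroups of every level group `Gal(𝒢_{∞,n}/𝒢)` have
  bounded order» — at `𝒢_θ`: they fix a tree vertex or edge, stabilisers ≅ `G/U_n`, `E/α⁻¹U_n`), the Zorn
  lemma `GaloisLevelData.exists_isMaximalCompactSubgroup_ge` (p438140) and abc-iut-L3-t5's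
  `not_maximalCompactIffVerticial_of_escaping_of_zorn` (p436977) give `¬ MaximalCompactIffVerticialAt 𝒢_θ`
  and `¬ MaximalCompactIffVerticial.{0}` (F-1750) under the same data as (iii).

NEGATIVE-MODULO form: the inputs are binders; bricks R1/R3/R4/R5/R6-level supply them at `G = F̂_p⟨a,b⟩`.
Nothing here bears on [IUTchIII] Cor. 3.12 (IUT uses finite dual semi-graphs only); no side taken.
-/

namespace Literature.AnabelianGeometry.SemiGraphs

namespace ProfiniteSemiGraph

open CategoryTheory Topology

section ThetaRayEscapeIV

variable {G E : Type} [Group G] [TopologicalSpace G] [IsTopologicalGroup G] [CompactSpace G]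
  [TotallyDisconnectedSpace G] [Group E] [TopologicalSpace E] [IsTopologicalGroup E] [CompactSpace E]
  [TotallyDisconnectedSpace E] {up : E →ₜ* G} {low : ℕ → (E →ₜ* G)}

/-- **The escape at the canonical chart, exported**: from the level-wise binders (hz) (hfin) (hfar) (hcrit)
on `z`, a COMPACT subgroup `C ≤ π₁^temp(𝒢_θ)` fixing no compatible system of vertices of the canonical
level trees (abc-iut-L3-d4's p438249 with `C := closure⟨lim z_k⟩`, `hC`, `hesc` exported).
[cite: MochizukiSemiAnbd2006, Thm 3.7(iii) pp.40-41] -/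
theorem thetaRay_exists_compact_escaping_of_levelEscape
    (h37 : (thetaRay G E up low).Thm37Hypotheses)
    (z : ℕ → (thetaRay G E up low).temperedPi h37.toProp36Hypotheses)
    (hz : ∀ j : ℕ, ∃ N : ℕ, ∀ k, N ≤ k →
      ((thetaRay G E up low).galoisLevelData h37.toProp36Hypotheses).proj h37.isCountable j (z (k + 1)) =
        ((thetaRay G E up low).galoisLevelData h37.toProp36Hypotheses).proj h37.isCountable j (z k))
    (hfin : ∀ j k : ℕ, IsOfFinOrder
      (((thetaRay G E up low).galoisLevelData h37.toProp36Hypotheses).proj h37.isCountable j (z k)))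
    (hfar : ∀ k j : ℕ, ∃ x : (((thetaRay G E up low).galoisLevelData h37.toProp36Hypotheses).tree j).Vertex,
      k ≤ (((thetaRay G E up low).galoisLevelData h37.toProp36Hypotheses).treeProj j).vertexMap x ∧
        (((thetaRay G E up low).galoisLevelData h37.toProp36Hypotheses).treeAct h37.isCountable j
          (z k)).hom.vertexMap x = x)
    (hcrit : ∀ n : ℕ, ∃ j₀ : ℕ, ∀ j, j₀ ≤ j → ∃ N : ℕ, ∀ k, N ≤ k →
      ∀ (y : (((thetaRay G E up low).galoisLevelData h37.toProp36Hypotheses).tree j).Vertex)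
        (b b' : (((thetaRay G E up low).galoisLevelData h37.toProp36Hypotheses).tree j).Branch),
        (((thetaRay G E up low).galoisLevelData h37.toProp36Hypotheses).tree j).abuts b = some y →
        (((thetaRay G E up low).galoisLevelData h37.toProp36Hypotheses).tree j).abuts b' = some y →
        (((thetaRay G E up low).galoisLevelData h37.toProp36Hypotheses).treeProj j).vertexMap y = n + 1 →
        (((thetaRay G E up low).galoisLevelData h37.toProp36Hypotheses).treeAct h37.isCountable j
            (z k)).hom.edgeMap
          ((((thetaRay G E up low).galoisLevelData h37.toProp36Hypotheses).tree j).edgeOf b) =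
          (((thetaRay G E up low).galoisLevelData h37.toProp36Hypotheses).tree j).edgeOf b →
        (((thetaRay G E up low).galoisLevelData h37.toProp36Hypotheses).treeAct h37.isCountable j
            (z k)).hom.edgeMap
          ((((thetaRay G E up low).galoisLevelData h37.toProp36Hypotheses).tree j).edgeOf b') =
          (((thetaRay G E up low).galoisLevelData h37.toProp36Hypotheses).tree j).edgeOf b' →
        (∃ (b₂ : (((thetaRay G E up low).galoisLevelData h37.toProp36Hypotheses).tree j).Branch)
           (v₂ : (((thetaRay G E up low).galoisLevelData h37.toProp36Hypotheses).tree j).Vertex), b₂ ≠ b ∧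
          (((thetaRay G E up low).galoisLevelData h37.toProp36Hypotheses).tree j).edgeOf b₂ =
            (((thetaRay G E up low).galoisLevelData h37.toProp36Hypotheses).tree j).edgeOf b ∧
          (((thetaRay G E up low).galoisLevelData h37.toProp36Hypotheses).tree j).abuts b₂ = some v₂ ∧
          (((thetaRay G E up low).galoisLevelData h37.toProp36Hypotheses).treeProj j).vertexMap v₂ =
            n + 2) →
        (∃ (b₂ : (((thetaRay G E up low).galoisLevelData h37.toProp36Hypotheses).tree j).Branch)
           (v₂ : (((thetaRay G E up low).galoisLevelData h37.toProp36Hypotheses).tree j).Vertex), b₂ ≠ b' ∧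
          (((thetaRay G E up low).galoisLevelData h37.toProp36Hypotheses).tree j).edgeOf b₂ =
            (((thetaRay G E up low).galoisLevelData h37.toProp36Hypotheses).tree j).edgeOf b' ∧
          (((thetaRay G E up low).galoisLevelData h37.toProp36Hypotheses).tree j).abuts b₂ = some v₂ ∧
          (((thetaRay G E up low).galoisLevelData h37.toProp36Hypotheses).treeProj j).vertexMap v₂ = n) →
        False) :
    ∃ C : Subgroup ((thetaRay G E up low).temperedPi h37.toProp36Hypotheses),
      IsCompact (C : Set ((thetaRay G E up low).temperedPi h37.toProp36Hypotheses)) ∧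
      ∀ x : ∀ j, ((verticialLevelData_temperedPiChart (h36 := h37.toProp36Hypotheses)).tree j).Vertex,
        (∀ ⦃i j⦄ (h : i ≤ j),
          ((verticialLevelData_temperedPiChart (h36 := h37.toProp36Hypotheses)).trans h).vertexMap (x j) =
            x i) →
        ∃ g ∈ C, ∃ j,
          ((verticialLevelData_temperedPiChart (h36 := h37.toProp36Hypotheses)).act j g).hom.vertexMap (x j) ≠
            x j := by
  -- abbreviations (as in p438249)
  set 𝒢 : ProfiniteSemiGraph.{0} := thetaRay G E up low
  have h36 : 𝒢.Prop36Hypotheses := h37.toProp36Hypotheses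
  set D : GaloisLevelData 𝒢 := 𝒢.galoisLevelData h36
  -- (2a) the limit `c := lim z_k`
  obtain ⟨c, hc⟩ := D.exists_forall_eventually_projAut_eq h36.isCountable z hz
  choose N hN using hc
  -- (2b) `C := closure⟨c⟩` is compact
  have hford : ∀ j, IsOfFinOrder (D.projAut h36.isCountable j c) := fun j => by
    rw [hN j (N j) le_rfl]; exact hfin j (N j)
  have hC : IsCompact ((Subgroup.zpowers c).topologicalClosure : Set (D.temperedPi h36.isCountable)) :=
    D.isCompact_topologicalClosure_zpowers h36.isCountable c hford
  have hcC : c ∈ (Subgroup.zpowers c).topologicalClosure :=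
    Subgroup.le_topologicalClosure _ (Subgroup.mem_zpowers c)
  -- the action of `c` at level `j` is that of `z_k`, `k ≥ N j`
  have hact : ∀ j k, N j ≤ k →
      D.treeAct h36.isCountable j c = D.treeAct h36.isCountable j (z k) := fun j k hk => by
    rw [D.treeAct_apply h36.isCountable, D.treeAct_apply h36.isCountable]
    exact congrArg _ (hN j k hk)
  refine ⟨(Subgroup.zpowers c).topologicalClosure, hC, ?_⟩
  refine (verticialLevelData_temperedPiChart (h36 := h36)).escaping_of_criticalFree (fun v : ℕ => v)
    SemiGraph.ray_heightStep ((Subgroup.zpowers c).topologicalClosure) c hcC ?_ ?_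
  · -- hfar for `c`
    intro j n
    obtain ⟨x, hx, hfix⟩ := hfar (max n (N j)) j
    refine ⟨x, le_trans (le_max_left _ _) hx, ?_⟩
    change (D.treeAct h36.isCountable j c).hom.vertexMap x = x
    rw [hact j (max n (N j)) (le_max_right _ _)]
    exact hfix
  · -- hcrit for `c`
    intro n
    obtain ⟨j₀, hj₀⟩ := hcrit n
    refine ⟨j₀, fun j hj y b b' hb hb' hy he he' hup hdown => ?_⟩
    obtain ⟨N', hN'⟩ := hj₀ j hj
    have hk : N' ≤ max N' (N j) := le_max_left _ _
    change (D.treeAct h36.isCountable j c).hom.edgeMap _ = _ at he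
    change (D.treeAct h36.isCountable j c).hom.edgeMap _ = _ at he'
    rw [hact j (max N' (N j)) (le_max_right _ _)] at he he'
    exact hN' _ hk y b b' hb hb' hy he he' hup hdown

/-- **Thm 3.7 (iv) FAILS at `𝒢_θ` under the level data of the escape plus ONE binder** `hbd` (the finite
subgroups of every level group `Gal(𝒢_{∞,n}/𝒢)` have bounded order): the escaping compact `C` lies in a
MAXIMAL compact subgroup (Zorn, `GaloisLevelData.exists_isMaximalCompactSubgroup_ge`, p438140), which is then
in no verticial subgroup (abc-iut-L3-t5, p436977). NEGATIVE-MODULO form.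
[cite: MochizukiSemiAnbd2006, Thm 3.7(iv) p.41] -/
theorem thetaRay_not_maximalCompactIffVerticial_of_levelEscape
    (h37 : (thetaRay G E up low).Thm37Hypotheses)
    (z : ℕ → (thetaRay G E up low).temperedPi h37.toProp36Hypotheses)
    (hz : ∀ j : ℕ, ∃ N : ℕ, ∀ k, N ≤ k →
      ((thetaRay G E up low).galoisLevelData h37.toProp36Hypotheses).proj h37.isCountable j (z (k + 1)) =
        ((thetaRay G E up low).galoisLevelData h37.toProp36Hypotheses).proj h37.isCountable j (z k))
    (hfin : ∀ j k : ℕ, IsOfFinOrder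
      (((thetaRay G E up low).galoisLevelData h37.toProp36Hypotheses).proj h37.isCountable j (z k)))
    (hfar : ∀ k j : ℕ, ∃ x : (((thetaRay G E up low).galoisLevelData h37.toProp36Hypotheses).tree j).Vertex,
      k ≤ (((thetaRay G E up low).galoisLevelData h37.toProp36Hypotheses).treeProj j).vertexMap x ∧
        (((thetaRay G E up low).galoisLevelData h37.toProp36Hypotheses).treeAct h37.isCountable j
          (z k)).hom.vertexMap x = x)
    (hcrit : ∀ n : ℕ, ∃ j₀ : ℕ, ∀ j, j₀ ≤ j → ∃ N : ℕ, ∀ k, N ≤ k →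
      ∀ (y : (((thetaRay G E up low).galoisLevelData h37.toProp36Hypotheses).tree j).Vertex)
        (b b' : (((thetaRay G E up low).galoisLevelData h37.toProp36Hypotheses).tree j).Branch),
        (((thetaRay G E up low).galoisLevelData h37.toProp36Hypotheses).tree j).abuts b = some y →
        (((thetaRay G E up low).galoisLevelData h37.toProp36Hypotheses).tree j).abuts b' = some y →
        (((thetaRay G E up low).galoisLevelData h37.toProp36Hypotheses).treeProj j).vertexMap y = n + 1 →
        (((thetaRay G E up low).galoisLevelData h37.toProp36Hypotheses).treeAct h37.isCountable j
            (z k)).hom.edgeMap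
          ((((thetaRay G E up low).galoisLevelData h37.toProp36Hypotheses).tree j).edgeOf b) =
          (((thetaRay G E up low).galoisLevelData h37.toProp36Hypotheses).tree j).edgeOf b →
        (((thetaRay G E up low).galoisLevelData h37.toProp36Hypotheses).treeAct h37.isCountable j
            (z k)).hom.edgeMap
          ((((thetaRay G E up low).galoisLevelData h37.toProp36Hypotheses).tree j).edgeOf b') =
          (((thetaRay G E up low).galoisLevelData h37.toProp36Hypotheses).tree j).edgeOf b' →
        (∃ (b₂ : (((thetaRay G E up low).galoisLevelData h37.toProp36Hypotheses).tree j).Branch)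
           (v₂ : (((thetaRay G E up low).galoisLevelData h37.toProp36Hypotheses).tree j).Vertex), b₂ ≠ b ∧
          (((thetaRay G E up low).galoisLevelData h37.toProp36Hypotheses).tree j).edgeOf b₂ =
            (((thetaRay G E up low).galoisLevelData h37.toProp36Hypotheses).tree j).edgeOf b ∧
          (((thetaRay G E up low).galoisLevelData h37.toProp36Hypotheses).tree j).abuts b₂ = some v₂ ∧
          (((thetaRay G E up low).galoisLevelData h37.toProp36Hypotheses).treeProj j).vertexMap v₂ =
            n + 2) →
        (∃ (b₂ : (((thetaRay G E up low).galoisLevelData h37.toProp36Hypotheses).tree j).Branch)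
           (v₂ : (((thetaRay G E up low).galoisLevelData h37.toProp36Hypotheses).tree j).Vertex), b₂ ≠ b' ∧
          (((thetaRay G E up low).galoisLevelData h37.toProp36Hypotheses).tree j).edgeOf b₂ =
            (((thetaRay G E up low).galoisLevelData h37.toProp36Hypotheses).tree j).edgeOf b' ∧
          (((thetaRay G E up low).galoisLevelData h37.toProp36Hypotheses).tree j).abuts b₂ = some v₂ ∧
          (((thetaRay G E up low).galoisLevelData h37.toProp36Hypotheses).treeProj j).vertexMap v₂ = n) →
        False)
    (hbd : ∀ n : ℕ, ∃ B : ℕ, ∀ H : Subgroup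
        (((thetaRay G E up low).galoisLevelData h37.toProp36Hypotheses).Gal h37.isCountable n),
      (H : Set (((thetaRay G E up low).galoisLevelData h37.toProp36Hypotheses).Gal h37.isCountable n)).Finite →
        Nat.card H ≤ B) :
    ¬ MaximalCompactIffVerticial.{0} := by
  obtain ⟨C, hC, hesc⟩ :=
    thetaRay_exists_compact_escaping_of_levelEscape h37 z hz hfin hfar hcrit
  exact (verticialLevelData_temperedPiChart (h36 := h37.toProp36Hypotheses)).not_maximalCompactIffVerticial_of_escaping_of_zorn
    h37 C hC
    (fun C' hC' => ((thetaRay G E up low).galoisLevelData h37.toProp36Hypotheses).exists_isMaximalCompactSubgroup_ge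
      h37.isCountable hbd C' hC')
    hesc

/-- The At-form: `¬ MaximalCompactIffVerticialAt 𝒢_θ` under the same binders. NEGATIVE-MODULO form.
[cite: MochizukiSemiAnbd2006, Thm 3.7(iv) p.41] -/
theorem thetaRay_not_maximalCompactIffVerticialAt_of_levelEscape
    (h37 : (thetaRay G E up low).Thm37Hypotheses)
    (z : ℕ → (thetaRay G E up low).temperedPi h37.toProp36Hypotheses)
    (hz : ∀ j : ℕ, ∃ N : ℕ, ∀ k, N ≤ k →
      ((thetaRay G E up low).galoisLevelData h37.toProp36Hypotheses).proj h37.isCountable j (z (k + 1)) =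
        ((thetaRay G E up low).galoisLevelData h37.toProp36Hypotheses).proj h37.isCountable j (z k))
    (hfin : ∀ j k : ℕ, IsOfFinOrder
      (((thetaRay G E up low).galoisLevelData h37.toProp36Hypotheses).proj h37.isCountable j (z k)))
    (hfar : ∀ k j : ℕ, ∃ x : (((thetaRay G E up low).galoisLevelData h37.toProp36Hypotheses).tree j).Vertex,
      k ≤ (((thetaRay G E up low).galoisLevelData h37.toProp36Hypotheses).treeProj j).vertexMap x ∧
        (((thetaRay G E up low).galoisLevelData h37.toProp36Hypotheses).treeAct h37.isCountable j
          (z k)).hom.vertexMap x = x)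
    (hcrit : ∀ n : ℕ, ∃ j₀ : ℕ, ∀ j, j₀ ≤ j → ∃ N : ℕ, ∀ k, N ≤ k →
      ∀ (y : (((thetaRay G E up low).galoisLevelData h37.toProp36Hypotheses).tree j).Vertex)
        (b b' : (((thetaRay G E up low).galoisLevelData h37.toProp36Hypotheses).tree j).Branch),
        (((thetaRay G E up low).galoisLevelData h37.toProp36Hypotheses).tree j).abuts b = some y →
        (((thetaRay G E up low).galoisLevelData h37.toProp36Hypotheses).tree j).abuts b' = some y →
        (((thetaRay G E up low).galoisLevelData h37.toProp36Hypotheses).treeProj j).vertexMap y = n + 1 →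
        (((thetaRay G E up low).galoisLevelData h37.toProp36Hypotheses).treeAct h37.isCountable j
            (z k)).hom.edgeMap
          ((((thetaRay G E up low).galoisLevelData h37.toProp36Hypotheses).tree j).edgeOf b) =
          (((thetaRay G E up low).galoisLevelData h37.toProp36Hypotheses).tree j).edgeOf b →
        (((thetaRay G E up low).galoisLevelData h37.toProp36Hypotheses).treeAct h37.isCountable j
            (z k)).hom.edgeMap
          ((((thetaRay G E up low).galoisLevelData h37.toProp36Hypotheses).tree j).edgeOf b') =
          (((thetaRay G E up low).galoisLevelData h37.toProp36Hypotheses).tree j).edgeOf b' →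
        (∃ (b₂ : (((thetaRay G E up low).galoisLevelData h37.toProp36Hypotheses).tree j).Branch)
           (v₂ : (((thetaRay G E up low).galoisLevelData h37.toProp36Hypotheses).tree j).Vertex), b₂ ≠ b ∧
          (((thetaRay G E up low).galoisLevelData h37.toProp36Hypotheses).tree j).edgeOf b₂ =
            (((thetaRay G E up low).galoisLevelData h37.toProp36Hypotheses).tree j).edgeOf b ∧
          (((thetaRay G E up low).galoisLevelData h37.toProp36Hypotheses).tree j).abuts b₂ = some v₂ ∧
          (((thetaRay G E up low).galoisLevelData h37.toProp36Hypotheses).treeProj j).vertexMap v₂ =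
            n + 2) →
        (∃ (b₂ : (((thetaRay G E up low).galoisLevelData h37.toProp36Hypotheses).tree j).Branch)
           (v₂ : (((thetaRay G E up low).galoisLevelData h37.toProp36Hypotheses).tree j).Vertex), b₂ ≠ b' ∧
          (((thetaRay G E up low).galoisLevelData h37.toProp36Hypotheses).tree j).edgeOf b₂ =
            (((thetaRay G E up low).galoisLevelData h37.toProp36Hypotheses).tree j).edgeOf b' ∧
          (((thetaRay G E up low).galoisLevelData h37.toProp36Hypotheses).tree j).abuts b₂ = some v₂ ∧
          (((thetaRay G E up low).galoisLevelData h37.toProp36Hypotheses).treeProj j).vertexMap v₂ = n) →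
        False)
    (hbd : ∀ n : ℕ, ∃ B : ℕ, ∀ H : Subgroup
        (((thetaRay G E up low).galoisLevelData h37.toProp36Hypotheses).Gal h37.isCountable n),
      (H : Set (((thetaRay G E up low).galoisLevelData h37.toProp36Hypotheses).Gal h37.isCountable n)).Finite →
        Nat.card H ≤ B) :
    ¬ MaximalCompactIffVerticialAt (thetaRay G E up low) := by
  obtain ⟨C, hC, hesc⟩ :=
    thetaRay_exists_compact_escaping_of_levelEscape h37 z hz hfin hfar hcrit
  obtain ⟨K, hK, hCK⟩ :=
    ((thetaRay G E up low).galoisLevelData h37.toProp36Hypotheses).exists_isMaximalCompactSubgroup_ge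
      h37.isCountable hbd C hC
  exact (verticialLevelData_temperedPiChart (h36 := h37.toProp36Hypotheses)).not_maximalCompactIffVerticialAt_of_escaping
    h37 C K hK hCK hesc

end ThetaRayEscapeIV

end ProfiniteSemiGraph

end Literature.AnabelianGeometry.SemiGraphs
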